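import Summits.FinalStateConjecture.FinalStateConjecture.Theorems.PhotonSphereChannelsFrozenPacketAnsatz
import Summits.FinalStateConjecture.FinalStateConjecture.Theorems.PhotonSphereChannelsCauchyWave
import Summits.FinalStateConjecture.FinalStateConjecture.Theorems.PhotonSphereChannelsBlindnessPotential

/-!
# Route PhotonSphereChannels · UniformPhotonSphereChannels (K1) — the frozen velocity packet at
# scale `m`: a Regge–Wheeler solution whose near-side energy below the packet is `≤ ε ∫ g²` at the
# times `±T`, `T` = packet width

Support file (everything proved) for item stmt-FinalStateConjecture-10045; the refutation of K1 is
assembled from `frozen_packet_main` in the next file.  Mechanism (no semiclassics, no long-time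
dynamics): for the spin-2 Regge–Wheeler potential `V_ℓ = V_{2,ℓ} ∘ r` along a tortoise radius
function and a near edge `xe`, take `ℓ = m⁴` and velocity data `(0, g)`,
`g(x) = B(m³(x − α))`, `α = xe − 3/m³` (a `C²` plateau bump of width `3/m³` flush below `xe`,
`∫ g² ≥ 1/m³`).  With `ω² = V_ℓ(α) ≍ m⁸` the frozen ansatz `g sin(ωt)/ω` has residual
`((V_ℓ − ω²)g − g'') sin(ωt)/ω` of sup-size `N ≲ (C₁ m⁵ + K₂ m⁶)/m⁴`, so by
`FrozenPacket.near_energy_le_at` the energy of the true solution (from `CauchyWave.exists_solution`)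
on `(−∞, α)` at time `T = 3/m³` — when the light-speed near edge `xe − t` has swept past the whole
packet — is `≤ (e − 1)T²·(3/m³)·N² ≲ (C₁² + K₂²)/(f₀ m⁵) ≤ ε/m³ ≤ ε ∫ g²` once
`m² ≳ (9C₁ + K₂)²/(ε f₀)`; the same at `−T` by time reversal.  No definitions are introduced.
-/

noncomputable section

open Set Filter MeasureTheory Topology Function

namespace Summit.FinalStateConjecture.FinalStateConjecture.Theorems.FrozenPacket

open Summit.FinalStateConjecture.FinalStateConjecture.Theorems.Blindness

/-- **The frozen velocity packet at scale `m`.** See the module docstring: given the plateau bump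
`B` (with `|B''| ≤ K₂`), the constants `f₀, C₀, C₁` of the potential on `[xe − 3, xe]`
(`V_ℓ ≥ ℓ(ℓ+1)f₀ − C₀`, `Lip(V_ℓ) ≤ (ℓ(ℓ+1)+1)C₁`) and a scale `m ≥ 2` with `m ≥ 2C₀/f₀` and
`m² ≥ 108(9C₁ + K₂)²/(εf₀)`, for `ℓ = m⁴` there are a `C²` velocity profile `g` supported in
`[α, xe]`, `α = xe − T`, `T = 3/m³`, with `∫ g² > 0`, and a global `C²` solution `ψ` of the
Regge–Wheeler equation with data `(0, g)`, supported in the domain of influence of `[α, xe]`,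
whose energy on `(−∞, α)` at the times `T` and `−T` is at most `ε ∫ g²`. -/
theorem frozen_packet_main {M : ℝ} {r : ℝ → ℝ} (hM : 0 < M) (hr : ∀ x, 2 * M < r x)
    (hr' : ∀ x, HasDerivAt r (1 - 2 * M / r x) x) (xe : ℝ) {ε : ℝ} (hε : 0 < ε)
    {B : ℝ → ℝ} (hB : ContDiff ℝ 2 B) (h0l : ∀ u, u ≤ 0 → B u = 0)
    (h0r : ∀ u, 3 ≤ u → B u = 0) (h1 : ∀ u ∈ Icc (1 : ℝ) 2, B u = 1)
    (h01 : ∀ u, 0 ≤ B u ∧ B u ≤ 1) {K₂ : ℝ} (hK₂ : 0 ≤ K₂) (hB2 : ∀ u, |iteratedDeriv 2 B u| ≤ K₂)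
    {f₀ C₀ C₁ : ℝ} (hf₀ : 0 < f₀) (hC₁ : 0 ≤ C₁)
    (hlow : ∀ ℓ : ℕ, ∀ x ∈ Icc (xe - 3) xe, (ℓ : ℝ) * ((ℓ : ℝ) + 1) * f₀ - C₀ ≤ (1 - 2 * M / r x) *
        ((ℓ : ℝ) * ((ℓ : ℝ) + 1) / r x ^ 2 + (1 - ((2 : ℕ) : ℝ) ^ 2) * (2 * M) / r x ^ 3))
    (hlip : ∀ ℓ : ℕ, ∀ x ∈ Icc (xe - 3) xe, ∀ y ∈ Icc (xe - 3) xe,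
        |(1 - 2 * M / r x) *
            ((ℓ : ℝ) * ((ℓ : ℝ) + 1) / r x ^ 2 + (1 - ((2 : ℕ) : ℝ) ^ 2) * (2 * M) / r x ^ 3)
          - (1 - 2 * M / r y) *
            ((ℓ : ℝ) * ((ℓ : ℝ) + 1) / r y ^ 2 + (1 - ((2 : ℕ) : ℝ) ^ 2) * (2 * M) / r y ^ 3)|
          ≤ ((ℓ : ℝ) * ((ℓ : ℝ) + 1) + 1) * C₁ * |x - y|)
    {m : ℕ} (hm2 : 2 ≤ m) (hmC : 2 * C₀ / f₀ ≤ m)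
    (hmε : 108 * (9 * C₁ + K₂) ^ 2 / (ε * f₀) ≤ (m : ℝ) ^ 2)
    (ℓ : ℕ) (hℓ : ℓ = m ^ 4) (V : ℝ → ℝ)
    (hV : V = fun x => (1 - 2 * M / r x) *
      ((ℓ : ℝ) * ((ℓ : ℝ) + 1) / r x ^ 2 + (1 - ((2 : ℕ) : ℝ) ^ 2) * (2 * M) / r x ^ 3)) :
    ∃ (g : ℝ → ℝ) (α T : ℝ), ContDiff ℝ 2 g ∧ α < xe ∧ 0 < T ∧ xe - T ≤ α ∧
      (∀ x, (x < α ∨ xe < x) → g x = 0) ∧ (∀ x, x ∉ Icc α xe → g x = 0) ∧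
      (∀ x, xe ≤ x → g x = 0) ∧
      Integrable (fun x => g x ^ 2) ∧ 0 < ∫ x, g x ^ 2 ∧
      ∃ ψ : ℝ → ℝ → ℝ, ContDiff ℝ 2 (uncurry ψ) ∧
        (∀ t x, iteratedDeriv 2 (fun τ => ψ τ x) t - iteratedDeriv 2 (ψ t) x + V x * ψ t x = 0) ∧
        (∀ x, ψ 0 x = 0) ∧ (∀ x, deriv (fun τ => ψ τ x) 0 = g x) ∧
        (∀ t x, (x < α - |t| ∨ xe + |t| < x) → ψ t x = 0) ∧
        (∀ t x, 0 ≤ deriv (fun τ => ψ τ x) t ^ 2 + deriv (ψ t) x ^ 2 + V x * ψ t x ^ 2) ∧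
        (∀ t, Integrable fun x =>
          deriv (fun τ => ψ τ x) t ^ 2 + deriv (ψ t) x ^ 2 + V x * ψ t x ^ 2) ∧
        (∫ x in Iio α, (deriv (fun τ => ψ τ x) T ^ 2 + deriv (ψ T) x ^ 2 + V x * ψ T x ^ 2))
          ≤ ε * ∫ x, g x ^ 2 ∧
        (∫ x in Iio α, (deriv (fun τ => ψ τ x) (-T) ^ 2 + deriv (ψ (-T)) x ^ 2
          + V x * ψ (-T) x ^ 2)) ≤ ε * ∫ x, g x ^ 2 := by
  -- scales
  have hm1 : (1 : ℝ) ≤ m := by exact_mod_cast (le_trans (by norm_num) hm2)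
  have hm0 : (0 : ℝ) < m := by linarith
  set c : ℝ := (m : ℝ) ^ 3 with hc
  have hc0 : 0 < c := by positivity
  have hcm : (m : ℝ) ≤ c := by
    rw [hc]; nlinarith [mul_le_mul hm1 hm1 zero_le_one hm0.le]
  have hc1 : 1 ≤ c := hm1.trans hcm
  have h3c' : 3 / c ≤ 3 := by rw [div_le_iff₀ hc0]; nlinarith
  have h3c0 : 0 < 3 / c := div_pos (by norm_num) hc0
  set ℓr : ℝ := (ℓ : ℝ) * ((ℓ : ℝ) + 1) with hℓr
  have hℓcast : (ℓ : ℝ) = (m : ℝ) ^ 4 := by rw [hℓ]; push_cast; ring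
  have hℓr8 : (m : ℝ) ^ 8 ≤ ℓr := by
    rw [hℓr, hℓcast]; nlinarith [pow_nonneg hm0.le 4]
  have hℓr3 : ℓr + 1 ≤ 3 * (m : ℝ) ^ 8 := by
    rw [hℓr, hℓcast]
    have h4 : (1 : ℝ) ≤ (m : ℝ) ^ 4 := one_le_pow₀ hm1
    nlinarith [pow_nonneg hm0.le 4]
  have hℓrm : (m : ℝ) ≤ ℓr := by
    refine le_trans ?_ hℓr8
    calc (m : ℝ) = (m : ℝ) ^ 1 := (pow_one _).symm
      _ ≤ (m : ℝ) ^ 8 := pow_le_pow_right₀ hm1 (by norm_num)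
  have hℓr0 : 0 < ℓr := lt_of_lt_of_le hm0 hℓrm
  have hℓ2 : 2 ≤ ℓ := by
    rw [hℓ]; calc 2 ≤ 2 ^ 4 := by norm_num
      _ ≤ m ^ 4 := Nat.pow_le_pow_left hm2 4
  -- the potential
  subst hV
  have hV1 := contDiff_one_potential hM hr hr' ℓ
  have hVpos := potential_pos hM hr hℓ2
  have hVnn : ∀ x, 0 ≤ (1 - 2 * M / r x) *
      ((ℓ : ℝ) * ((ℓ : ℝ) + 1) / r x ^ 2 + (1 - ((2 : ℕ) : ℝ) ^ 2) * (2 * M) / r x ^ 3) :=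
    fun x => (hVpos x).le
  have hVb := abs_potential_le hM hr ℓ
  set Vf : ℝ → ℝ := fun x => (1 - 2 * M / r x) *
      ((ℓ : ℝ) * ((ℓ : ℝ) + 1) / r x ^ 2 + (1 - ((2 : ℕ) : ℝ) ^ 2) * (2 * M) / r x ^ 3) with hVf
  -- the profile: `g(x) = B(c(x − α))`, `α = xe − 3/c`
  set α : ℝ := xe - 3 / c with hα
  have hαxe : α + 3 / c = xe := by rw [hα]; ring
  have hαlt : α < xe := by rw [hα]; linarith
  obtain ⟨hg2, hg0l, hg0r, hg1, hg01, hg''⟩ := scaled_profile hB h0l h0r h1 h01 hc0 α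
  set g : ℝ → ℝ := fun x => B (c * (x - α)) with hg
  rw [hαxe] at hg0r
  have hgoff : ∀ x, x ∉ Icc α xe → g x = 0 := by
    intro x hx
    by_cases h : x ≤ α
    · exact hg0l x h
    · exact hg0r x (le_of_not_ge fun h' => hx ⟨le_of_not_ge h, h'⟩)
  have hgoff' : ∀ x, (x < α ∨ xe < x) → g x = 0 :=
    fun x hx => hgoff x fun h => by rcases hx with hx | hx <;> linarith [h.1, h.2]
  have hgint : Integrable fun x => g x ^ 2 :=
    integrable_of_exterior (a := α) (b := xe) (hg2.continuous.pow 2)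
      (fun x hx => by simp [hgoff' x hx])
  -- `∫ g² ≥ 1/c`
  have hE0low : 1 / c ≤ ∫ x, g x ^ 2 := by
    have hstep2 : (∫ x in Icc (α + 1 / c) (α + 2 / c), g x ^ 2) ≤ ∫ x, g x ^ 2 :=
      setIntegral_le_integral hgint (Eventually.of_forall fun x => sq_nonneg _)
    refine le_trans (le_of_eq ?_) hstep2
    have h1c : α + 1 / c ≤ α + 2 / c := by
      have : 1 / c ≤ 2 / c := div_le_div_of_nonneg_right (by norm_num) hc0.le
      linarith
    rw [setIntegral_congr_fun measurableSet_Icc (g := fun _ => (1 : ℝ))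
      (fun x hx => by rw [show g x = 1 from hg1 x hx]; norm_num), setIntegral_const,
      Real.volume_real_Icc_of_le h1c, smul_eq_mul, mul_one]
    ring
  have hE0pos : 0 < ∫ x, g x ^ 2 := lt_of_lt_of_le (by positivity) hE0low
  -- the solution with data `(0, g)`
  obtain ⟨ψ, hψ2, hsol, hψ0, hψ1, hsupp⟩ :=
    CauchyWave.exists_solution (A := fun _ => 0) (B := g) (α := α) (β := xe) hV1 hVb
      contDiff_const (fun _ _ => rfl) (hg2.of_le (by norm_num)) hgoff
  have he0 : ∀ t x, 0 ≤ deriv (fun τ => ψ τ x) t ^ 2 + deriv (ψ t) x ^ 2 + Vf x * ψ t x ^ 2 :=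
    fun t x => by have := mul_nonneg (hVnn x) (sq_nonneg (ψ t x)); positivity
  have hInt : ∀ t, Integrable fun x =>
      deriv (fun τ => ψ τ x) t ^ 2 + deriv (ψ t) x ^ 2 + Vf x * ψ t x ^ 2 :=
    fun t => integrable_energyDensity hV1.continuous hψ2 hsupp t
  -- the frequency `ω² = V(α)` and the residual bound `ω N = 3(ℓr+1)C₁/c + c²K₂`
  set ω : ℝ := Real.sqrt (Vf α) with hω
  have hω0 : 0 < ω := Real.sqrt_pos.2 (hVpos α)
  have hω2 : ω ^ 2 = Vf α := Real.sq_sqrt (hVnn α)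
  set N' : ℝ := 3 * (ℓr + 1) * C₁ / c + c ^ 2 * K₂ with hN'
  have hN'0 : 0 ≤ N' := by positivity
  set N : ℝ := N' / ω with hN
  have hN0 : 0 ≤ N := div_nonneg hN'0 hω0.le
  have hωN : ω * N = N' := by rw [hN]; field_simp
  have hres_g : ∀ x, |(Vf x - ω ^ 2) * g x - iteratedDeriv 2 g x| ≤ ω * N := by
    intro x
    rw [hωN]
    by_cases hx : x ∈ Icc α xe
    · have hxK : x ∈ Icc (xe - 3) xe := ⟨by rw [hα] at hx; linarith [hx.1], hx.2⟩
      have hαK : α ∈ Icc (xe - 3) xe := ⟨by rw [hα]; linarith, hαlt.le⟩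
      have hVd : |Vf x - Vf α| ≤ (ℓr + 1) * C₁ * (3 / c) := by
        refine (hlip ℓ x hxK α hαK).trans ?_
        rw [abs_of_nonneg (by linarith [hx.1])]
        exact mul_le_mul_of_nonneg_left (by rw [hα] at hx ⊢; linarith [hx.2]) (by positivity)
      have hgx : |g x| ≤ 1 := by
        rw [abs_of_nonneg (hg01 x).1]; exact (hg01 x).2
      have hg''x : |iteratedDeriv 2 g x| ≤ c ^ 2 * K₂ := by
        rw [hg'' x, abs_mul, abs_of_nonneg (by positivity)]
        exact mul_le_mul_of_nonneg_left (hB2 _) (by positivity)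
      rw [hω2]
      calc |(Vf x - Vf α) * g x - iteratedDeriv 2 g x|
          ≤ |(Vf x - Vf α) * g x| + |iteratedDeriv 2 g x| := abs_sub _ _
        _ = |Vf x - Vf α| * |g x| + |iteratedDeriv 2 g x| := by rw [abs_mul]
        _ ≤ (ℓr + 1) * C₁ * (3 / c) * 1 + c ^ 2 * K₂ :=
            add_le_add (mul_le_mul hVd hgx (abs_nonneg _) (by positivity)) hg''x
        _ = N' := by rw [hN']; ring
    · have hx' : x < α ∨ xe < x := by
        by_contra h
        exact hx ⟨le_of_not_gt fun h' => h (Or.inl h'), le_of_not_gt fun h' => h (Or.inr h')⟩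
      have hgev : g =ᶠ[𝓝 x] fun _ => (0 : ℝ) := by
        rcases hx' with hx' | hx'
        · filter_upwards [Iio_mem_nhds hx'] with y hy using hgoff' y (Or.inl hy)
        · filter_upwards [Ioi_mem_nhds hx'] with y hy using hgoff' y (Or.inr hy)
      rw [hgoff x hx, iteratedDeriv_two_eq_zero_of_eventuallyEq hgev]
      simp [hN'0]
  -- the same bound for `−g` (data of the time-reversed solution)
  have hres_ng : ∀ x, |(Vf x - ω ^ 2) * (-g x) - iteratedDeriv 2 (fun y => -g y) x| ≤ ω * N := by
    intro x
    rw [iteratedDeriv_fun_neg 2 g x]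
    have h := hres_g x
    rwa [← abs_neg, show -((Vf x - ω ^ 2) * g x - iteratedDeriv 2 g x)
      = (Vf x - ω ^ 2) * (-g x) - -iteratedDeriv 2 g x by ring] at h
  -- the near-side bounds at `T = 3/c` and `−T`
  set T : ℝ := 3 / c with hT
  have hTmem : T ∈ Icc 0 T := ⟨h3c0.le, le_rfl⟩
  have hplus := near_energy_le_at hV1 hVnn hψ2 hsol hsupp hψ0 hψ1 hg2 hgoff' hαlt.le hω0 h3c0
    hres_g T hTmem
  obtain ⟨hψr2, hsolr, hsuppr, hψr0, hψr1, her⟩ := time_reverse hψ2 hsol hsupp hψ0 hψ1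
  have hminus' := near_energy_le_at (ψ := fun s y => ψ (-s) y) hV1 hVnn hψr2 hsolr hsuppr hψr0
    hψr1 hg2.neg (fun x hx => by rw [hgoff' x hx, neg_zero]) hαlt.le hω0 h3c0 hres_ng T hTmem
  have hminus : (∫ x in Iio α, (deriv (fun τ => ψ τ x) (-T) ^ 2 + deriv (ψ (-T)) x ^ 2
      + Vf x * ψ (-T) x ^ 2)) ≤ (Real.exp 1 - 1) * T ^ 2 * ((xe - α) * N ^ 2) := by
    rw [← setIntegral_congr_fun measurableSet_Iio (fun x _ => her T x)]
    exact hminus'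
  -- bookkeeping: `(e − 1) T² (xe − α) N² ≤ ε/c ≤ ε ∫ g²`
  have hexp2 : Real.exp 1 - 1 ≤ 2 := by
    have := Real.exp_one_lt_d9; norm_num at this; linarith
  have hexp0 : 0 ≤ Real.exp 1 - 1 := by linarith [Real.add_one_le_exp (1:ℝ)]
  have hN'D : N' ≤ (9 * C₁ + K₂) * (m : ℝ) ^ 6 := by
    have ha : 3 * (ℓr + 1) * C₁ ≤ 9 * (m : ℝ) ^ 8 * C₁ := by
      have := mul_le_mul_of_nonneg_right hℓr3 hC₁
      linarith
    have hb : 3 * (ℓr + 1) * C₁ / c ≤ 9 * (m : ℝ) ^ 8 * C₁ / c :=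
      div_le_div_of_nonneg_right ha hc0.le
    have hc' : 9 * (m : ℝ) ^ 8 * C₁ / c = 9 * C₁ * (m : ℝ) ^ 5 := by
      rw [div_eq_iff hc0.ne', hc]; ring
    have hd : 9 * C₁ * (m : ℝ) ^ 5 ≤ 9 * C₁ * (m : ℝ) ^ 6 :=
      mul_le_mul_of_nonneg_left (pow_le_pow_right₀ hm1 (by norm_num)) (by positivity)
    have he : c ^ 2 * K₂ = K₂ * (m : ℝ) ^ 6 := by rw [hc]; ring
    rw [hN', he]
    linarith
  -- `ω² ≥ ℓr f₀ / 2 ≥ m⁸ f₀ / 2`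
  have hω2low : (m : ℝ) ^ 8 * f₀ / 2 ≤ ω ^ 2 := by
    rw [hω2]
    have hαK : α ∈ Icc (xe - 3) xe := ⟨by rw [hα]; linarith, hαlt.le⟩
    have h := hlow ℓ α hαK
    have hℓf : 2 * C₀ ≤ ℓr * f₀ := by
      have h1 : 2 * C₀ ≤ (m : ℝ) * f₀ := by rwa [div_le_iff₀ hf₀] at hmC
      exact h1.trans (mul_le_mul_of_nonneg_right hℓrm hf₀.le)
    have h8 : (m : ℝ) ^ 8 * f₀ ≤ ℓr * f₀ := mul_le_mul_of_nonneg_right hℓr8 hf₀.le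
    refine le_trans ?_ h
    change (m : ℝ) ^ 8 * f₀ / 2 ≤ ℓr * f₀ - C₀
    linarith
  -- `N² ≤ 2 (9C₁+K₂)² m⁴ / f₀`
  have hN2 : N ^ 2 ≤ 2 * (9 * C₁ + K₂) ^ 2 * (m : ℝ) ^ 4 / f₀ := by
    have hD : 0 ≤ 9 * C₁ + K₂ := by positivity
    have h1 : N ^ 2 = N' ^ 2 / ω ^ 2 := by rw [hN, div_pow]
    have h2 : N' ^ 2 ≤ (9 * C₁ + K₂) ^ 2 * (m : ℝ) ^ 12 := by
      calc N' ^ 2 ≤ ((9 * C₁ + K₂) * (m : ℝ) ^ 6) ^ 2 := pow_le_pow_left₀ hN'0 hN'D 2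
        _ = (9 * C₁ + K₂) ^ 2 * (m : ℝ) ^ 12 := by ring
    rw [h1, div_le_div_iff₀ (by positivity) hf₀]
    calc N' ^ 2 * f₀ ≤ (9 * C₁ + K₂) ^ 2 * (m : ℝ) ^ 12 * f₀ :=
          mul_le_mul_of_nonneg_right h2 hf₀.le
      _ = 2 * (9 * C₁ + K₂) ^ 2 * (m : ℝ) ^ 4 * ((m : ℝ) ^ 8 * f₀ / 2) := by ring
      _ ≤ 2 * (9 * C₁ + K₂) ^ 2 * (m : ℝ) ^ 4 * ω ^ 2 :=
          mul_le_mul_of_nonneg_left hω2low (by positivity)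
  have hkey : (Real.exp 1 - 1) * T ^ 2 * ((xe - α) * N ^ 2) ≤ ε * ∫ x, g x ^ 2 := by
    have hxeα : xe - α = 3 / c := by rw [hα]; ring
    have hcc : c ^ 3 = (m : ℝ) ^ 9 := by rw [hc]; ring
    -- the largeness condition `108 (9C₁+K₂)² ≤ ε f₀ m²`
    have hm' : 108 * (9 * C₁ + K₂) ^ 2 ≤ ε * f₀ * (m : ℝ) ^ 2 := by
      have h := hmε
      rw [div_le_iff₀ (mul_pos hε hf₀)] at h
      linarith only [h]
    have hstep : (Real.exp 1 - 1) * T ^ 2 * ((xe - α) * N ^ 2) ≤ ε * (1 / c) := by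
      rw [hxeα, hT]
      calc (Real.exp 1 - 1) * (3 / c) ^ 2 * (3 / c * N ^ 2)
          = (Real.exp 1 - 1) * (27 * N ^ 2 / c ^ 3) := by field_simp; ring
        _ ≤ 2 * (27 * N ^ 2 / c ^ 3) := mul_le_mul_of_nonneg_right hexp2 (by positivity)
        _ ≤ 2 * (27 * (2 * (9 * C₁ + K₂) ^ 2 * (m : ℝ) ^ 4 / f₀) / c ^ 3) := by gcongr
        _ = 108 * (9 * C₁ + K₂) ^ 2 * (m : ℝ) ^ 4 / (f₀ * (m : ℝ) ^ 9) := by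
            rw [hcc]; field_simp; ring
        _ ≤ ε * f₀ * (m : ℝ) ^ 2 * (m : ℝ) ^ 4 / (f₀ * (m : ℝ) ^ 9) := by gcongr
        _ = ε * (1 / c) := by rw [hc]; field_simp
    exact hstep.trans (mul_le_mul_of_nonneg_left hE0low hε.le)
  -- assemble
  refine ⟨g, α, T, hg2, hαlt, h3c0, by rw [hT, hα], hgoff', hgoff, hg0r, hgint, hE0pos, ψ, hψ2,
    hsol, hψ0, hψ1, hsupp, he0, hInt, hplus.trans hkey, hminus.trans hkey⟩

end Summit.FinalStateConjecture.FinalStateConjecture.Theorems.FrozenPacket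

end
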